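import Literature.NumberTheory.Sieve.GoldbachLinnikRomanovCertTop

/-!
# The same certificate, read at its own value: `romanovConst ≤ 1.93841`

`GoldbachLinnikRomanovCertTop` proves `romanovConst ≤ 1.94` from a kernel-checked certificate whose
assembled value is HEAD(orders `< 2^15`, primes `≤ 4 599 989`, with inflation) `= 1.9372228…` plus the
far-range bound `A₁·T(15) = 0.0011857…`, i.e. `1.9384085…`; the deduction `romanovConst_le_of_cert`
hard-codes the bound `194/100`.  This file restates that deduction with a generic rational bound `B`
and instantiates it at `193841/100000`.  No new certificate data: the SAME records, cofactor checks and
head tuple (`certAll_recs'`, `cofOK_recs`, `head_total`) are reused.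

Use: every explicit lower bound for Romanov's constant by the Elsholtz–Schlage-Puchta residue-class
method needs an upper bound for the TAIL of `R₀ = Σ_d g(d)/ord_d(2)` beyond a computed head; that tail is
`≤ B − head`, so replacing `B = 1.94` by `1.93841` halves the certification loss (parity-ideate p3, ROUND-13).
-/

namespace Literature.NumberTheory.Sieve.RomanovCert

open Literature.NumberTheory.Sieve.Romanov GoldbachLinnik SingularSeriesMean

/-- Generic-bound form of `romanovConst_le_of_cert`: the certified prime list, the cofactor checks, the
kernel head tuple on `[1, 2^15)` and a rational inequality `HEAD + A₁·T(15) ≤ B` give `romanovConst ≤ B`.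
[cite: HeathbrownPuchta2002, §5 (41)] -/
theorem romanovConst_le_of_cert_le {recs : List (ℕ × List ℕ)} (hcert : certAll recs = true)
    (hcof : CofOK recs) {Tp Tn Ip Sp Sn : ℕ}
    (hhead : headSums recs 1 (MM - 1) = (Tp, Tn, Ip, Sp, Sn, true)) {B : ℚ}
    (hnum : ((Tp : ℚ) - Tn + Ip) / 2 ^ 60 - ((Sp : ℚ) - Sn) / (2 ^ 60 * 32768) +
      A1Q * (1346161 / 1228800000) ≤ B) :
    romanovConst ≤ ((B : ℚ) : ℝ) := by
  refine Real.tsum_le_of_sum_range_le (fun t => div_nonneg (fq_nonneg 1 t) (Nat.cast_nonneg _))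
    fun X => (sum_range_le_of_cert hcert hcof hhead X).trans ?_
  rw [TjR_fifteen]
  have h' : ((((Tp : ℚ) - Tn + Ip) / 2 ^ 60 - ((Sp : ℚ) - Sn) / (2 ^ 60 * 32768) +
      A1Q * (1346161 / 1228800000) : ℚ) : ℝ) ≤ ((B : ℚ) : ℝ) := by exact_mod_cast hnum
  push_cast at h'
  rw [show (2 : ℝ) ^ KK = 2 ^ 60 from rfl, show ((MM : ℕ) : ℝ) = 32768 by unfold MM; norm_num]
  linarith

set_option maxHeartbeats 0 in
/-- The rational inequality `HEAD + A₁ · T(15) ≤ 1.93841` (the certificate's own value is `1.9384085…`). [folklore] -/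
private theorem final_num_193841 : (((49538575189018459529 : ℕ) : ℚ) - (47305768984179276217 : ℕ) + (1059608656172275 : ℕ)) / 2 ^ 60 -
    (((246339422258495582753820 : ℕ) : ℚ) - (246326315600758265887969 : ℕ)) / (2 ^ 60 * 32768) + A1Q * (1346161 / 1228800000) ≤ 193841 / 100000 := by
  norm_num [A1Q, c0iQ, pkQ, cb0, cb1, cb2, cb3, cb4, cb5]

end Literature.NumberTheory.Sieve.RomanovCert

namespace Literature.NumberTheory.Sieve.GoldbachLinnik

open RomanovCert in
/-- **Romanov's constant is at most `1.93841`** — the kernel-checked certificate of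
`GoldbachLinnikRomanovCertTop` read at its assembled value instead of the rounded `1.94`.
[cite: HeathbrownPuchta2002, §5 (41)] -/
theorem romanovConst_le_193841 : romanovConst ≤ 1.93841 :=
  (romanovConst_le_of_cert_le certAll_recs' cofOK_recs head_total final_num_193841).trans (by norm_num)

end Literature.NumberTheory.Sieve.GoldbachLinnik
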